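import Summits.QuantumFields.BalabanUV.T4Continuum.Spine.NE2.CovariantTablePairingLaw
import Summits.QuantumFields.BalabanUV.T4Continuum.Support.CovariantBlockAveragingTower
import Summits.QuantumFields.BalabanUV.T4Continuum.Support.AveragingSummandRate

/-!
# T⁴ programme, spine node NE2 (U1a) — R14 W1, file 4: TOWER PACKAGING of the table averaging — `E_k(T) = √(n_k^d)·(Q_k(T_k) − Q_k ⊗ 1)`,
# its size, the Gram identity, and the `E`-datum `AveragingLaws` of the Gram law from the table's size `τ` and two-level consistency `θ_k`
# (cell `pub-balaban-gaps`, seat ne2 gen 3; plan `run/shared/lean/pub/pub-balaban-gaps/ne/NE2-R14-PLAN.md` W1)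

Row B3's `Support/CovariantBlockAveragingTower` + `PairingLaw` §4 for a TOWER OF TRANSPORTER TABLES `T : (k : ℕ) → Table d (lev L k) M o`: **`QcovLevT`**, **`EcovT`**,
`Bfree_add_EcovT`, **`opNorm_EcovT_le`** (`‖E_k(T)‖ ≤ card o·τ` from `‖T_k(y,j,μ,t) − 1‖ ≤ τ`), **`gram_eqT`** (`(B_k + E_k)ᴴ(B_k + E_k) − B_kᴴB_k = n_k^d·(Q_k(T_k)ᴴQ_k(T_k) − Q_kᴴQ_k ⊗ 1)` —
print's (3.16)/(3.26) `Q*(U) a Q(U)` shape for ANY table), `opNorm_EcovT_succ_mul_J_sub_le`, and **`averagingLaws_EcovT`** / `averagingLaws_EcovT_geom`: the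
`GramPerturbationLaw.AveragingLaws` datum `(D_k ⊗ 1, E_k(T), J_k ⊗ 1, card o·τ, Cst·card o·(θ_k + τ·L^{−k}))` with the table's two-level consistency `hT2` and size `hTτ` DISPLAYED
(row B3's `averagingLaws_Ecov` is the instance `T_k = ctr (R k)` with `τ = e^{(d+1)α} − 1`).  With this, the row-B3.b Gram law (`GramPerturbationLaw`) applies to `E_k(T)` verbatim;
§5–§7 (W1′): **`avgPertT T`** = `a·(n_k^dQ_k(T_k)ᴴQ_k(T_k) − Q_kᴴQ_k ⊗ 1)` — print's (3.16)/(3.26) averaging term for ANY table tower (`avgPert_eq_avgPertT`: the model's `NE2BalabanRoot.avgPert R` is the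
ctr-table instance, rfl), **`perturbationLaws_avgPertT(_rate)`** (row B3.b's target shape from the table data via the Gram core + `averagingLaws_Bfree`), and **`tierB_table_rate_at_one`**
= ROOT B ∘ `NE2BalabanLayer.tierB_rate_at_one` with `avgPertT T` in the B3 slot, CONDITIONAL on hreg/hNE3/hT2/hTτ/hP₄/threshold.  What R14 still owes: W2 (Bałaban's composed
table as DATA + its two data from (3.35)/NE3 shapes), W3 ((124) remainder).
HONEST FRAMING (T4-DAG p. 1).  Bookkeeping about TYPED operators; `T`, `θ`, `τ` DATA/hypotheses asserted by nobody; nothing of [B7] (124)/(15) constructed (DIVERGENCE F6 (ζ)); NOT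
NE2, NOT [B9] (3.16)/(3.26) as printed; NE2 (U1a) NOT PROVED; spine PROVED 0/9 unchanged; NOT continuum YM / infinite volume / mass gap / Clay.  HONEST DEPENDENCY: continuum YM on
T⁴ ⇐ BetaPertH ∧ nine spine estimates (0/9 proved); BetaPertH ⇐ (D1) ∧ (D4) ∧ CAP+tail; G-an2-4 gates asym, D1 and NE2/3/4.  No `sorry`.
-/

noncomputable section

open scoped BigOperators ComplexConjugate Matrix Matrix.Norms.L2Operator Kronecker

namespace Summit.QuantumFields.BalabanUV.T4Continuum.NE2.CovariantTableTower

open Literature.MathematicalPhysics.QuantumFieldTheory.Balaban1983to89.B5Prop11Plancherel (Tor fine unitVec Cst Cst_nonneg)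
open Literature.MathematicalPhysics.QuantumFieldTheory.Balaban1983to89.B5Block118 (QvOp)
open Literature.MathematicalPhysics.QuantumFieldTheory.Balaban1983to89.B5G183RateUnitTower (lev lev_neZero)
open Summit.QuantumFields.BalabanUV.T4Continuum
open Summit.QuantumFields.BalabanUV.T4Continuum.BalabanAveragedTowerUnit (idx one_le_lev' cast_lev')
open Summit.QuantumFields.BalabanUV.T4Continuum.KingPairingPlantedLaw (JK JpcT calDalev calDalev_inv opNorm_inv_calDalev_le)
open Summit.QuantumFields.BalabanUV.T4Continuum.LineAveragingPairing (glue)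
open Summit.QuantumFields.BalabanUV.T4Continuum.GramPerturbationLaw (AveragingLaws)
open Summit.QuantumFields.BalabanUV.T4Continuum.KroneckerLift
open Summit.QuantumFields.BalabanUV.T4Continuum.CovariantBlockAveraging (sqrtVol Bfree norm_sqrtVol opNorm_QvOp_le averagingLaws_mono)
open Summit.QuantumFields.BalabanUV.T4Continuum.NE2.CovariantTableAveraging (Table QcovT opNorm_QcovT_sub_kron_le)
open Summit.QuantumFields.BalabanUV.T4Continuum.NE2.CovariantTablePairing (pairDT)
open Summit.QuantumFields.BalabanUV.T4Continuum.NE2.CovariantTablePairingLaw (opNorm_pairing_leT)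
open Literature.MathematicalPhysics.QuantumFieldTheory.Balaban1983to89.T4EtaRateMin (LocalRate)
open Summit.QuantumFields.BalabanUV.T4Continuum.BalabanAveragedTowerUnit (Qlev)
open Summit.QuantumFields.BalabanUV.T4Continuum.KingPairingPlantedLaw (CJ CJ_nonneg)
open Summit.QuantumFields.BalabanUV.T4Continuum.GramPerturbationLaw (gramPert gramCore C2gram perturbationLaws_gramPert e2gram_le_geom)
open Summit.QuantumFields.BalabanUV.T4Continuum.NE2FromNE3 (bgReadings)
open Summit.QuantumFields.BalabanUV.T4Continuum.CovariantBlockAveraging (transport contour)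
open Summit.QuantumFields.BalabanUV.T4Continuum.NE2BalabanRoot (avgPert)
open Summit.QuantumFields.BalabanUV.T4Continuum.CovariantAveragingTower (TowerLimitRate)
open Summit.QuantumFields.BalabanUV.T4Continuum.LineAveragingPairing (averagingLaws_Bfree)
open Summit.QuantumFields.BalabanUV.T4Continuum.RegularBackgroundTower (RegularTransporters regClass)
open Summit.QuantumFields.BalabanUV.T4Continuum.BackgroundResolventTower (PerturbationLaws Cpert)
open Summit.QuantumFields.BalabanUV.T4Continuum.PerturbationAlgebra (perturbationLaws_mono)
open Summit.QuantumFields.BalabanUV.T4Continuum.KroneckerLift (freeTowerLaws_kron)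
open Summit.QuantumFields.BalabanUV.T4Continuum.NE2PerturbedLayer (freeTowerLaws_king)
open Summit.QuantumFields.BalabanUV.T4Continuum.NE2ColourPerturbedLayer (opNorm_inv_calDalev_kron_le)
open Summit.QuantumFields.BalabanUV.T4Continuum.CovariantAveragingSummand (kappaQ)
open Summit.QuantumFields.BalabanUV.T4Continuum.NE2BalabanLayer (tierBPert kappaB C2B tierB_rate_at_one perturbationLaws_tierB)

variable {d : ℕ} (L : ℕ) [NeZero L] (M : Fin d → ℕ) [hM : ∀ μ, NeZero (M μ)] {o : Type*} [Fintype o] [DecidableEq o]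

/-- the table averaging at level `k` of a tower of tables. [folklore] -/
def QcovLevT (T : (k : ℕ) → Table d (lev L k) M o) (k : ℕ) : Matrix ((Tor M × Fin d) × o) (idx L M k × o) ℂ :=
  QcovT (lev L k) M (T k)

/-- **THE TRANSPORT ERROR OF A TABLE TOWER** `E_k(T) = √(n_k^d)·(Q_k(T_k) − Q_k ⊗ 1)`. [folklore] -/
def EcovT (T : (k : ℕ) → Table d (lev L k) M o) (k : ℕ) : Matrix ((Tor M × Fin d) × o) (idx L M k × o) ℂ :=
  sqrtVol d L k • (QcovLevT L M T k - QvOp (lev L k) M ⊗ₖ (1 : Matrix o o ℂ))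

omit [NeZero L] hM [Fintype o] in
/-- `B_k + E_k(T) = √(n_k^d)·Q_k(T_k)`. [folklore] -/
theorem Bfree_add_EcovT (T : (k : ℕ) → Table d (lev L k) M o) (k : ℕ) :
    Bfree L M k + EcovT L M T k = sqrtVol d L k • QcovLevT L M T k := by
  rw [Bfree, EcovT, ← smul_add, add_sub_cancel]

/-- **SIZE ALONG THE TOWER**: `‖E_k(T)‖ ≤ card o·τ` from `‖T_k(y,j,μ,t) − 1‖ ≤ τ` (`t < n_k`) at every level. [folklore] -/
theorem opNorm_EcovT_le {T : (k : ℕ) → Table d (lev L k) M o} {τ : ℝ} (hτ : 0 ≤ τ)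
    (hT : ∀ k y j μ (t : Fin (lev L k)), ‖T k y j μ t - 1‖ ≤ τ) (k : ℕ) : ‖EcovT L M T k‖ ≤ Fintype.card o * τ := by
  haveI := lev_neZero L k
  have hpos : 0 < Real.sqrt (((lev L k : ℕ) : ℝ) ^ d) :=
    Real.sqrt_pos.mpr (pow_pos (by exact_mod_cast Nat.pos_of_ne_zero (NeZero.ne (lev L k))) d)
  rw [EcovT, norm_smul, norm_sqrtVol, QcovLevT]
  calc Real.sqrt (((lev L k : ℕ) : ℝ) ^ d) * ‖QcovT (lev L k) M (T k) - QvOp (lev L k) M ⊗ₖ (1 : Matrix o o ℂ)‖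
      ≤ Real.sqrt (((lev L k : ℕ) : ℝ) ^ d) * (Fintype.card o * τ * (Real.sqrt (((lev L k : ℕ) : ℝ) ^ d))⁻¹) :=
        mul_le_mul_of_nonneg_left (opNorm_QcovT_sub_kron_le (lev L k) M hτ (hT k)) hpos.le
    _ = Fintype.card o * τ := by field_simp

omit [NeZero L] in
/-- **THE GRAM IDENTITY FOR TABLES**: `(B_k + E_k(T))ᴴ(B_k + E_k(T)) − B_kᴴB_k = n_k^d·(Q_k(T_k)ᴴQ_k(T_k) − (Q_kᴴQ_k) ⊗ 1)` — print's `Q*(U) a Q(U) − a Q*Q ⊗ 1` shape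
((3.16)/(3.26), `Q* = n^dQᴴ`) for any table. [folklore] -/
theorem gram_eqT (T : (k : ℕ) → Table d (lev L k) M o) (k : ℕ) :
    (Bfree L M k + EcovT L M T k)ᴴ * (Bfree L M k + EcovT L M T k) - (Bfree (o := o) L M k)ᴴ * Bfree (o := o) L M k
      = (((lev L k : ℕ) : ℂ) ^ d) • ((QcovLevT L M T k)ᴴ * QcovLevT L M T k - ((QvOp (lev L k) M)ᴴ * QvOp (lev L k) M) ⊗ₖ (1 : Matrix o o ℂ)) := by
  have hreal : star (sqrtVol d L k) = sqrtVol d L k := by rw [sqrtVol]; exact Complex.conj_ofReal _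
  have hsq : sqrtVol d L k * sqrtVol d L k = ((lev L k : ℕ) : ℂ) ^ d := by
    rw [sqrtVol, ← Complex.ofReal_mul, Real.mul_self_sqrt (pow_nonneg (Nat.cast_nonneg _) d)]
    push_cast; rfl
  rw [Bfree_add_EcovT]
  rw [Bfree, Matrix.conjTranspose_smul, Matrix.conjTranspose_smul, hreal, Matrix.smul_mul, Matrix.mul_smul, smul_smul,
    Matrix.smul_mul, Matrix.mul_smul, smul_smul, hsq, ← smul_sub, kron_conjTranspose, ← kron_mul]

/-- **THE SANDWICH-FREE TWO-LEVEL LAW OF `E_k(T)`**: `‖E_{k+1}(J_k ⊗ 1) − E_k‖ ≤ card o·(θ_k + τ·L^{−k})`. [folklore] -/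
theorem opNorm_EcovT_succ_mul_J_sub_le {T : (k : ℕ) → Table d (lev L k) M o} {θ : ℕ → ℝ} {τ : ℝ} (hθ : ∀ k, 0 ≤ θ k) (hτ : 0 ≤ τ)
    (hT2 : ∀ (k : ℕ) (y : Tor M) (μ : Fin d) (j : Fin d → Fin (lev L k)) (r : Fin d → Fin L) (t' : ℕ), t' < L * lev L k →
      ‖T (k + 1) y (glue (lev L k) L (j, r)) μ t' - T k y j μ (((r μ : ℕ) + t') / L)‖ ≤ θ k)
    (hTτ : ∀ (k : ℕ) (y : Tor M) (μ : Fin d) (j : Fin d → Fin (lev L k)) (s : ℕ), s ≤ lev L k → ‖T k y j μ s - 1‖ ≤ τ) (k : ℕ) :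
    ‖EcovT L M T (k + 1) * (JpcT L M k ⊗ₖ (1 : Matrix o o ℂ)) - EcovT L M T k‖ ≤ Fintype.card o * (θ k + τ / (lev L k : ℕ)) := by
  have h := opNorm_pairing_leT (lev L k) L M (hθ k) hτ (hT2 k) (hTτ k)
  rw [EcovT, EcovT, Matrix.smul_mul]
  exact h

variable (a : ℝ) (ha : 0 < a)

/-- **THE `E`-DATUM OF THE GRAM LAW FOR A TABLE TOWER**: `AveragingLaws (D ⊗ 1) (E(T)) (J ⊗ 1) (card o·τ) (k ↦ Cst·card o·(θ_k + τ·L^{−k}))` from the table's size `τ`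
and two-level consistency `θ_k` — both DISPLAYED (for Bałaban's composed table: (3.35) sizes and node NE3's consistency of every averaged field).
[cite: Balaban1984PropagatorsI, Prop. 1.1 (1.89) p.33 (‖Δ_a⁻¹‖ ≤ Cst)] [folklore] -/
theorem averagingLaws_EcovT {T : (k : ℕ) → Table d (lev L k) M o} {τ : ℝ} {θ : ℕ → ℝ} (hθ : ∀ k, 0 ≤ θ k) (hτ : 0 ≤ τ)
    (hT2 : ∀ (k : ℕ) (y : Tor M) (μ : Fin d) (j : Fin d → Fin (lev L k)) (r : Fin d → Fin L) (t' : ℕ), t' < L * lev L k →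
      ‖T (k + 1) y (glue (lev L k) L (j, r)) μ t' - T k y j μ (((r μ : ℕ) + t') / L)‖ ≤ θ k)
    (hTτ : ∀ (k : ℕ) (y : Tor M) (μ : Fin d) (j : Fin d → Fin (lev L k)) (s : ℕ), s ≤ lev L k → ‖T k y j μ s - 1‖ ≤ τ) :
    AveragingLaws (fun k => calDalev L M a ha k ⊗ₖ (1 : Matrix o o ℂ)) (EcovT L M T) (fun k => JpcT L M k ⊗ₖ (1 : Matrix o o ℂ))
      (Fintype.card o * τ) (fun k => Cst d a * (Fintype.card o * (θ k + τ / (lev L k : ℕ)))) where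
  opNorm_le := fun k => opNorm_EcovT_le L M hτ (fun k y j μ t => hTτ k y μ j t (le_of_lt t.isLt)) k
  pair_mul_inv_le := fun k => by
    have hG : ‖(calDalev L M a ha k ⊗ₖ (1 : Matrix o o ℂ))⁻¹‖ ≤ Cst d a := by
      rw [kron_inv]; exact (opNorm_kron_le o _).trans (opNorm_inv_calDalev_le L M a ha k)
    calc _ ≤ ‖EcovT L M T (k + 1) * (JpcT L M k ⊗ₖ (1 : Matrix o o ℂ)) - EcovT L M T k‖ * ‖(calDalev L M a ha k ⊗ₖ (1 : Matrix o o ℂ))⁻¹‖ :=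
          Matrix.l2_opNorm_mul _ _
      _ ≤ Fintype.card o * (θ k + τ / (lev L k : ℕ)) * Cst d a :=
          mul_le_mul (opNorm_EcovT_succ_mul_J_sub_le L M hθ hτ hT2 hTτ k) hG (norm_nonneg _)
            (mul_nonneg (Nat.cast_nonneg _) (add_nonneg (hθ k) (div_nonneg hτ (Nat.cast_nonneg _))))
      _ = _ := by ring
  inv_mul_pair_le := fun k => by
    have hG : ‖(calDalev L M a ha k ⊗ₖ (1 : Matrix o o ℂ))⁻¹‖ ≤ Cst d a := by
      rw [kron_inv]; exact (opNorm_kron_le o _).trans (opNorm_inv_calDalev_le L M a ha k)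
    have hH : ((calDalev L M a ha k ⊗ₖ (1 : Matrix o o ℂ))⁻¹)ᴴ = (calDalev L M a ha k ⊗ₖ (1 : Matrix o o ℂ))⁻¹ := by
      rw [kron_inv, kron_conjTranspose, calDalev_inv]
      congr 1
      exact (Literature.MathematicalPhysics.QuantumFieldTheory.Balaban1983to89.B5Prop11Plancherel.calG_isHermitian (lev L k)
        (one_le_lev' L k) M a ha).eq
    rw [← Matrix.l2_opNorm_conjTranspose, Matrix.conjTranspose_mul, Matrix.conjTranspose_conjTranspose, hH]
    calc _ ≤ ‖EcovT L M T (k + 1) * (JpcT L M k ⊗ₖ (1 : Matrix o o ℂ)) - EcovT L M T k‖ * ‖(calDalev L M a ha k ⊗ₖ (1 : Matrix o o ℂ))⁻¹‖ :=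
          Matrix.l2_opNorm_mul _ _
      _ ≤ Fintype.card o * (θ k + τ / (lev L k : ℕ)) * Cst d a :=
          mul_le_mul (opNorm_EcovT_succ_mul_J_sub_le L M hθ hτ hT2 hTτ k) hG (norm_nonneg _)
            (mul_nonneg (Nat.cast_nonneg _) (add_nonneg (hθ k) (div_nonneg hτ (Nat.cast_nonneg _))))
      _ = _ := by ring

/-- **GEOMETRIC FORM** (the shape `GramPerturbationLaw.perturbationLaws_gram_king` consumes): `θ_k ≤ θ₀·L^{−k}` ⟹ pairing sequence `(Cst·card o·(θ₀ + τ))·L^{−k}`. [folklore] -/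
theorem averagingLaws_EcovT_geom {T : (k : ℕ) → Table d (lev L k) M o} {τ θ₀ : ℝ} {θ : ℕ → ℝ} (hθ : ∀ k, 0 ≤ θ k) (hτ : 0 ≤ τ)
    (hθg : ∀ k, θ k ≤ θ₀ * ((L : ℝ)⁻¹) ^ k)
    (hT2 : ∀ (k : ℕ) (y : Tor M) (μ : Fin d) (j : Fin d → Fin (lev L k)) (r : Fin d → Fin L) (t' : ℕ), t' < L * lev L k →
      ‖T (k + 1) y (glue (lev L k) L (j, r)) μ t' - T k y j μ (((r μ : ℕ) + t') / L)‖ ≤ θ k)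
    (hTτ : ∀ (k : ℕ) (y : Tor M) (μ : Fin d) (j : Fin d → Fin (lev L k)) (s : ℕ), s ≤ lev L k → ‖T k y j μ s - 1‖ ≤ τ) :
    AveragingLaws (fun k => calDalev L M a ha k ⊗ₖ (1 : Matrix o o ℂ)) (EcovT L M T) (fun k => JpcT L M k ⊗ₖ (1 : Matrix o o ℂ))
      (Fintype.card o * τ) (fun k => (Cst d a * Fintype.card o * (θ₀ + τ)) * ((L : ℝ)⁻¹) ^ k) := by
  refine averagingLaws_mono (averagingLaws_EcovT L M a ha hθ hτ hT2 hTτ) fun k => ?_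
  have hlev : (τ / (lev L k : ℕ) : ℝ) = τ * ((L : ℝ)⁻¹) ^ k := by rw [cast_lev', inv_pow, div_eq_mul_inv]
  rw [hlev]
  have hC := Cst_nonneg d a
  have hLk : 0 ≤ ((L : ℝ)⁻¹) ^ k := by positivity
  calc Cst d a * (Fintype.card o * (θ k + τ * ((L : ℝ)⁻¹) ^ k))
      ≤ Cst d a * (Fintype.card o * (θ₀ * ((L : ℝ)⁻¹) ^ k + τ * ((L : ℝ)⁻¹) ^ k)) := by gcongr; exact hθg k
    _ = (Cst d a * Fintype.card o * (θ₀ + τ)) * ((L : ℝ)⁻¹) ^ k := by ring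

/-! ## §5 The averaging summand of a table tower in the target shape (W1′) -/

/-- **THE COVARIANT-AVERAGING SUMMAND OF A TABLE TOWER** `a·(n_k^d·Q_k(T_k)ᴴQ_k(T_k) − (Q_kᴴQ_k) ⊗ 1)` — print's `Q*(U) a Q(U)` minus its free part, for any transporter table
(the model's `NE2BalabanRoot.avgPert R` is the instance `T_k = ctr (R k)`). [cite: Balaban1985BackgroundPropagators, (3.16) p.393, (3.26) p.395 (shape); Balaban1984PropagatorsI, (1.69) p.29] [folklore] -/
def avgPertT (T : (k : ℕ) → Table d (lev L k) M o) (k : ℕ) : Matrix (idx L M k × o) (idx L M k × o) ℂ :=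
  (a : ℂ) • ((((lev L k : ℕ) : ℂ) ^ d) • ((QcovLevT L M T k)ᴴ * QcovLevT L M T k - ((QvOp (lev L k) M)ᴴ * QvOp (lev L k) M) ⊗ₖ (1 : Matrix o o ℂ)))

omit [NeZero L] in
/-- the summand is the scaled Gram perturbation of the free inner averaging by the table's transport error. [folklore] -/
theorem gramPert_Bfree_EcovT (T : (k : ℕ) → Table d (lev L k) M o) (c : ℂ) :
    gramPert c (Bfree (o := o) L M) (EcovT L M T)
      = fun k => c • ((((lev L k : ℕ) : ℂ) ^ d) • ((QcovLevT L M T k)ᴴ * QcovLevT L M T k - ((QvOp (lev L k) M)ᴴ * QvOp (lev L k) M) ⊗ₖ (1 : Matrix o o ℂ))) := by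
  funext k
  rw [gramPert, gramCore, gram_eqT]

omit [NeZero L] in
/-- `avgPertT T = gramPert a B E(T)`. [folklore] -/
theorem avgPertT_eq_gramPert (T : (k : ℕ) → Table d (lev L k) M o) : avgPertT L M a T = gramPert (a : ℂ) (Bfree (o := o) L M) (EcovT L M T) := by
  rw [gramPert_Bfree_EcovT]; rfl

omit [NeZero L] in
/-- **THE MODEL's SUMMAND IS THE INSTANCE `T_k = ctr (R k)`** (row B3's contour transporters): `avgPert R = avgPertT (k ↦ (y,j,μ,t) ↦ transport (R k) μ (contour y j μ t))`
(definitional, via `CovariantTableAveraging.QcovT_transport`). [folklore] -/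
theorem avgPert_eq_avgPertT (R : (k : ℕ) → Fin d → (idx L M k → Matrix o o ℂ)) :
    avgPert L M a R = avgPertT L M a (fun k y j μ t => transport (fine (lev L k) M) (R k) μ (contour (lev L k) M y j μ t)) := rfl

/-! ## §6 Row B3.b's target shape for the table summand -/

include ha in
/-- **THE TABLE SUMMAND IN THE TARGET SHAPE AT RATE `ρ ≥ L⁻¹`** from an `E(T)`-datum of size `card o·τ` and pairing `Cδ·ρ^k`:
`PerturbationLaws (Δ_a ⊗ 1) (avgPertT T) (J ⊗ 1) (kappaQ d a a (card o·τ)) (k ↦ a·C2gram Cst 1 (card o·τ) (2dCst) CJ Cst Cδ·ρ^k)` — Gram core + `averagingLaws_Bfree`. [folklore] -/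
theorem perturbationLaws_avgPertT_rate {T : (k : ℕ) → Table d (lev L k) M o} {τ Cδ ρ : ℝ} (hτ : 0 ≤ τ) (hρ : ((L : ℝ)⁻¹) ≤ ρ)
    (hE : AveragingLaws (fun k => calDalev L M a ha k ⊗ₖ (1 : Matrix o o ℂ)) (EcovT L M T) (fun k => JpcT L M k ⊗ₖ (1 : Matrix o o ℂ))
      (Fintype.card o * τ) (fun k => Cδ * ρ ^ k)) :
    PerturbationLaws (fun k => calDalev L M a ha k ⊗ₖ (1 : Matrix o o ℂ)) (avgPertT L M a T) (fun k => JpcT L M k ⊗ₖ (1 : Matrix o o ℂ))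
      (kappaQ d a (a : ℂ) (Fintype.card o * τ))
      (fun k => a * C2gram (Cst d a) 1 (Fintype.card o * τ) (2 * d * Cst d a) (CJ d a) (Cst d a) Cδ * ρ ^ k) := by
  have h := perturbationLaws_gramPert (freeTowerLaws_kron o (freeTowerLaws_king L M a ha)) (opNorm_inv_calDalev_kron_le L M a ha)
    (averagingLaws_Bfree L M a ha) hE (a : ℂ)
  rw [← avgPertT_eq_gramPert] at h
  have hna : ‖(a : ℂ)‖ = a := by rw [Complex.norm_real, Real.norm_of_nonneg ha.le]
  have hL0 : (0 : ℝ) ≤ (L : ℝ)⁻¹ := inv_nonneg.mpr (Nat.cast_nonneg L)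
  have hpow : ∀ k : ℕ, ((L : ℝ)⁻¹) ^ k ≤ ρ ^ k := fun k => pow_le_pow_left₀ hL0 hρ k
  have hε : 0 ≤ (Fintype.card o : ℝ) * τ := by positivity
  refine perturbationLaws_mono h (le_of_eq ?_) fun k => ?_
  · rw [kappaQ]; ring
  · refine (mul_le_mul_of_nonneg_left (e2gram_le_geom (ρ := ρ) (C₀ := 2 * d * Cst d a) (C₁ := CJ d a) (Cf := Cst d a) (Cδ := Cδ)
      (Cst_nonneg d a) zero_le_one hε
      (fun k => mul_le_mul_of_nonneg_left (hpow k) (by positivity [Cst_nonneg d a]))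
      (fun k => mul_le_mul_of_nonneg_left (hpow k) (CJ_nonneg d a))
      (fun k => mul_le_mul_of_nonneg_left (hpow k) (Cst_nonneg d a)) (fun k => le_rfl) k) (norm_nonneg _)).trans (le_of_eq ?_)
    rw [hna]; ring

include ha in
/-- **THE TABLE SUMMAND IN THE TARGET SHAPE FROM THE TABLE's OWN DATA** (size `τ`, geometric two-level consistency `θ_k ≤ θ₀·L^{−k}` — both DISPLAYED; for Bałaban's composed
table they are (3.35) sizes and node NE3's consistency of the averaged fields): rate `L^{−k}`, `Cδ = Cst·card o·(θ₀ + τ)`. [folklore] -/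
theorem perturbationLaws_avgPertT {T : (k : ℕ) → Table d (lev L k) M o} {τ θ₀ : ℝ} {θ : ℕ → ℝ} (hθ : ∀ k, 0 ≤ θ k) (hτ : 0 ≤ τ)
    (hθg : ∀ k, θ k ≤ θ₀ * ((L : ℝ)⁻¹) ^ k)
    (hT2 : ∀ (k : ℕ) (y : Tor M) (μ : Fin d) (j : Fin d → Fin (lev L k)) (r : Fin d → Fin L) (t' : ℕ), t' < L * lev L k →
      ‖T (k + 1) y (glue (lev L k) L (j, r)) μ t' - T k y j μ (((r μ : ℕ) + t') / L)‖ ≤ θ k)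
    (hTτ : ∀ (k : ℕ) (y : Tor M) (μ : Fin d) (j : Fin d → Fin (lev L k)) (s : ℕ), s ≤ lev L k → ‖T k y j μ s - 1‖ ≤ τ) :
    PerturbationLaws (fun k => calDalev L M a ha k ⊗ₖ (1 : Matrix o o ℂ)) (avgPertT L M a T) (fun k => JpcT L M k ⊗ₖ (1 : Matrix o o ℂ))
      (kappaQ d a (a : ℂ) (Fintype.card o * τ))
      (fun k => a * C2gram (Cst d a) 1 (Fintype.card o * τ) (2 * d * Cst d a) (CJ d a) (Cst d a) (Cst d a * Fintype.card o * (θ₀ + τ)) * ((L : ℝ)⁻¹) ^ k) :=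
  perturbationLaws_avgPertT_rate L M a ha hτ le_rfl (averagingLaws_EcovT_geom L M a ha hθ hτ hθg hT2 hTτ)

/-! ## §7 ROOT B ∘ tier B with the table summand in the B3 slot -/

include ha in
/-- **ROOT B WITH THE TABLE AVERAGING TERM** (`L ≥ 2`, `d ≥ 1`, `t = 1`): the King-averaged colour covariances of
`(Δ_a^{(k)} ⊗ 1 + covLap(R_k) + a·(n_k^dQ_k(T_k)ᴴQ_k(T_k) − Q_kᴴQ_k ⊗ 1) + P₄,k)⁻¹` converge to the named limit at rate `L^{−k}` — CONDITIONAL on rows B5/NE3 (`hreg`, `hNE3`), the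
TABLE data (`hT2`, `hTτ`), the fourth-slot law `hP₄` (row B4 / `Δ′` / site sandwich), and the threshold.  With `T :=` Bałaban's composed table this is print's (3.26) averaging
term verbatim (modulo W2/W3); NE2 NOT proved. [cite: Balaban1985BackgroundPropagators, (3.26) p.395 (shape); King1986, Lemma 4.5 (4.32)/(4.38) p.674 (template)] [folklore] -/
theorem tierB_table_rate_at_one (hL : 2 ≤ L) (hd : 1 ≤ d) {R : (k : ℕ) → Fin d → (idx L M k → Matrix o o ℂ)} {α β : ℝ}
    (hreg : RegularTransporters L M R α β) {C : ℝ} (hC : 0 ≤ C) (hNE3 : LocalRate (bgReadings L M (regClass L M R)) C ((L : ℝ)⁻¹))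
    {T : (k : ℕ) → Table d (lev L k) M o} {τ θ₀ : ℝ} {θ : ℕ → ℝ} (hθ : ∀ k, 0 ≤ θ k) (hτ : 0 ≤ τ) (hθg : ∀ k, θ k ≤ θ₀ * ((L : ℝ)⁻¹) ^ k)
    (hT2 : ∀ (k : ℕ) (y : Tor M) (μ : Fin d) (j : Fin d → Fin (lev L k)) (r : Fin d → Fin L) (t' : ℕ), t' < L * lev L k →
      ‖T (k + 1) y (glue (lev L k) L (j, r)) μ t' - T k y j μ (((r μ : ℕ) + t') / L)‖ ≤ θ k)
    (hTτ : ∀ (k : ℕ) (y : Tor M) (μ : Fin d) (j : Fin d → Fin (lev L k)) (s : ℕ), s ≤ lev L k → ‖T k y j μ s - 1‖ ≤ τ)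
    {P₄ : (k : ℕ) → Matrix (idx L M k × o) (idx L M k × o) ℂ} {κ₄ C₄ : ℝ}
    (hP₄ : PerturbationLaws (fun k => calDalev L M a ha k ⊗ₖ (1 : Matrix o o ℂ)) P₄ (fun k => JpcT L M k ⊗ₖ (1 : Matrix o o ℂ)) κ₄ (fun k => C₄ * ((L : ℝ)⁻¹) ^ k))
    (hsmall : kappaB o d a α β C (kappaQ d a (a : ℂ) (Fintype.card o * τ)) κ₄ < 1) :
    TowerLimitRate (fun k => Qlev L M k ⊗ₖ (1 : Matrix o o ℂ)) ((L : ℝ) ^ d)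
      (fun k => (calDalev L M a ha k ⊗ₖ (1 : Matrix o o ℂ) + tierBPert L M R (avgPertT L M a T) P₄ k)⁻¹)
      (Cpert (kappaB o d a α β C (kappaQ d a (a : ℂ) (Fintype.card o * τ)) κ₄) (2 * d * Cst d a) (CJ d a)
        (C2B o d L a α β C (a * C2gram (Cst d a) 1 (Fintype.card o * τ) (2 * d * Cst d a) (CJ d a) (Cst d a) (Cst d a * Fintype.card o * (θ₀ + τ))) C₄) 0 1)
      ((L : ℝ)⁻¹) :=
  tierB_rate_at_one L M a ha hL hd hreg hC hNE3 (perturbationLaws_avgPertT L M a ha hθ hτ hθg hT2 hTτ) hP₄ hsmall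

end Summit.QuantumFields.BalabanUV.T4Continuum.NE2.CovariantTableTower

end
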